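import Mathlib
import HarnessLib
import Summits.Ventures.LatticeQCDFlow.Exactness.JitteredHMC

/-!
# The jittered update with a positive-mass set of labels sharing a Doeblin minorant converges from every start — the abstract half of the atomless-jitter route

HONEST FRAMING: exact (Metropolis-corrected) sampling algorithms for lattice gauge theory;
figures of merit are autocorrelation/cost numbers at stated couplings and volumes; no
continuum-physics claim.

Venture `LatticeQCDFlow` (cell pub-lqcd), topic `Exactness`, FANOUT row 9 (eng-latcore, GEN-23; the engine's
`hmc.HMC.trajectory(…, tau_jitter = j)`).  NEW WORK of the cell over GEN-22's `JitteredHMC.lean` (`jitterHMC`,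
`jitterHMC_apply` — the jittered update is the `η`-mixture of the frozen-label updates; `smul_frozen_le_jitterHMC`,
`jitterHMC_nHit_minorised_of_atom`, `jitterHMC_uniformlyErgodic_of_atom` — the ATOM case) and the tree's
`PiGroupKicks.smul_nHit_le_nHit`, `DoeblinUniqueness` / `MetropolisSweepConvergence` (`uniformlyErgodic_of_nHit_minorised`,
`invariant_unique_of_minorised`, `invariant_nHit`).  Nothing is cited as a fact; no number is claimed.

WHY.  GEN-22 typed ergodicity of `tau_jitter` through an ATOM of the jitter law (the code's 53-bit uniform has
`2^53` atoms, so the engine as run is covered whenever the shortest reachable length is below `τ₀`).  The idealised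
CONTINUOUS jitter law has no atom; the route recorded in the gen-22 README replaces the atom by a set `G` of labels of
positive `η`-mass whose frozen updates `K_e`, `e ∈ G`, share ONE statewise sub-Markov minorant `W` with a Doeblin
power.  This file proves that abstract half: `K_jit ≥ η(G) · W` statewise, hence `K_jit^{k+1} ≥ η(G)^{k+1} · W^{k+1}
≥ (η(G)^{k+1} a) · ν`, hence convergence from every start and uniqueness.  With `G = {e₀}`, `W = K_{e₀}` it is
GEN-22's atom theorem.

## Content (`jitterHMC Φ hΦ S T η μP` as in `JitteredHMC.lean`; `G` a measurable set of labels; `W` any kernel)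

* **`smul_le_jitterHMC_of_common_minorant`** — `W u ≤ K_e u` for all `e ∈ G`, all `u` ⇒ `η(G) • W u ≤ K_jit u` for all `u`.
* **`jitterHMC_nHit_minorised_of_common_minorant`** — if moreover `a • ν ≤ W^{k+1} u` for all `u` then
  `(η(G)^{k+1} a) • ν ≤ K_jit^{k+1} u` for all `u`.
* **`jitterHMC_uniformlyErgodic_of_common_minorant`** — `η`, `μP`, `ν` probability laws, `η(G) ≠ 0`, `a ≠ 0`, `π` an
  invariant probability law of `K_jit`: for some `δ ∈ (0, 1]`, `|μ₀ K_jitᵗ(A) − π(A)| ≤ (1 − δ)^{⌊t/(k+1)⌋}` for EVERY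
  initial law, every `t`, every `A`, and `π` is the unique invariant probability law.

NOT CLAIMED: the INSTANCE — a common minorant `W` for the engine's leapfrog kernels over an interval of step sizes
(it needs the constants of gen-15/18's chart minorisation uniform in the step, not extracted); any rate; floating
point.  The engine as run (atomic jitter law) is GEN-22's `wilson_sunWilsonForceJitterHMC_uniformlyErgodic`.
-/

noncomputable section

namespace Summit.Ventures.LatticeQCDFlow.Exactness

open MeasureTheory ProbabilityTheory ProbabilityTheory.Kernel Set Function
open scoped ENNReal

variable {Ω P E : Type*} [MeasurableSpace Ω] [MeasurableSpace P] [MeasurableSpace E]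

section CommonMinorant

variable {Φ : E → Ω × P → Ω × P} {hΦ : Measurable (jitterMap Φ)} {S : Ω → ℝ} {T : P → ℝ}
  {η : Measure E} {μP : Measure P}

/-- **THE JITTERED UPDATE DOMINATES `η(G) ·` ANY COMMON MINORANT OF THE FROZEN UPDATES OVER `G`**: if
`W u ≤ K_e u` for every label `e ∈ G` (`G` measurable) and every state `u`, then `η(G) • W u ≤ K_jit u` for every `u`. -/
theorem smul_le_jitterHMC_of_common_minorant [SFinite η] [SFinite μP] (hS : Measurable S) (hT : Measurable T)
    {G : Set E} (hG : MeasurableSet G) {W : Kernel Ω Ω}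
    (hW : ∀ e ∈ G, ∀ u, W u ≤ refreshUpdate (involMH (Φ e) (measurable_of_jitterMap hΦ e)
      fun z : Ω × P => S z.1 + T z.2) μP u) (u : Ω) :
    η G • W u ≤ jitterHMC Φ hΦ S T η μP u := by
  refine Measure.le_iff.2 fun A hA => ?_
  rw [Measure.smul_apply, smul_eq_mul, jitterHMC_apply Φ hΦ η μP hS hT u hA]
  calc η G * W u A = ∫⁻ _ in G, W u A ∂η := by rw [MeasureTheory.setLIntegral_const, mul_comm]
    _ ≤ ∫⁻ e in G, refreshUpdate (involMH (Φ e) (measurable_of_jitterMap hΦ e)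
          fun z : Ω × P => S z.1 + T z.2) μP u A ∂η := by
        refine setLIntegral_mono' hG fun e he => ?_
        exact Measure.le_iff'.1 (hW e he u) A
    _ ≤ _ := setLIntegral_le_lintegral _ _

/-- **A DOEBLIN POWER OF THE COMMON MINORANT PASSES TO THE JITTERED UPDATE**: if moreover `a • ν ≤ W^{k+1} u` for
every `u`, then `(η(G)^{k+1} a) • ν ≤ K_jit^{k+1} u` for every `u`. -/
theorem jitterHMC_nHit_minorised_of_common_minorant [SFinite η] [SFinite μP] (hS : Measurable S)
    (hT : Measurable T) {G : Set E} (hG : MeasurableSet G) {W : Kernel Ω Ω}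
    (hW : ∀ e ∈ G, ∀ u, W u ≤ refreshUpdate (involMH (Φ e) (measurable_of_jitterMap hΦ e)
      fun z : Ω × P => S z.1 + T z.2) μP u)
    {ν : Measure Ω} {a : ℝ≥0∞} {k : ℕ} (h : ∀ u, a • ν ≤ nHit W (k + 1) u) :
    ∀ u, (η G ^ (k + 1) * a) • ν ≤ nHit (jitterHMC Φ hΦ S T η μP) (k + 1) u := fun u =>
  calc (η G ^ (k + 1) * a) • ν = η G ^ (k + 1) • (a • ν) := by rw [smul_smul]
    _ ≤ η G ^ (k + 1) • nHit W (k + 1) u := by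
        refine Measure.le_iff'.2 fun B => ?_
        simp only [Measure.smul_apply, smul_eq_mul]
        exact mul_le_mul' le_rfl (Measure.le_iff'.1 (h u) B)
    _ ≤ nHit (jitterHMC Φ hΦ S T η μP) (k + 1) u :=
        smul_nHit_le_nHit (fun v => smul_le_jitterHMC_of_common_minorant (hΦ := hΦ) hS hT hG hW v) (k + 1) u

/-- **THE JITTERED CHAIN CONVERGES FROM EVERY START WHEN A POSITIVE-MASS SET OF LABELS SHARES A DOEBLIN MINORANT.**
`η`, `μP` probability laws; `G` measurable with `η(G) ≠ 0`; `W u ≤ K_e u` for all `e ∈ G`, `u`; `a • ν ≤ W^{k+1} u`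
for all `u` (`ν` a probability law, `a ≠ 0`); `π` an invariant probability law of the jittered update.  Then for
some `δ ∈ (0, 1]`: `|μ₀ K_jitᵗ(A) − π(A)| ≤ (1 − δ)^{⌊t/(k+1)⌋}` for EVERY initial law `μ₀`, every `t`, every `A`, and
`π` is the unique invariant probability law of `K_jit`.  (`G = {e₀}`, `W = K_{e₀}`: GEN-22's atom theorem.) -/
theorem jitterHMC_uniformlyErgodic_of_common_minorant [IsProbabilityMeasure η] [IsProbabilityMeasure μP]
    (hS : Measurable S) (hT : Measurable T) {π : Measure Ω} [IsProbabilityMeasure π]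
    (hinv : Invariant (jitterHMC Φ hΦ S T η μP) π) {G : Set E} (hG : MeasurableSet G) (hηG : η G ≠ 0)
    {W : Kernel Ω Ω}
    (hW : ∀ e ∈ G, ∀ u, W u ≤ refreshUpdate (involMH (Φ e) (measurable_of_jitterMap hΦ e)
      fun z : Ω × P => S z.1 + T z.2) μP u)
    {ν : Measure Ω} [IsProbabilityMeasure ν] {a : ℝ≥0∞} (ha : a ≠ 0) {k : ℕ}
    (h : ∀ u, a • ν ≤ nHit W (k + 1) u) :
    ∃ δ : ℝ, 0 < δ ∧ δ ≤ 1 ∧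
      (∀ (μ₀ : Measure Ω) [IsProbabilityMeasure μ₀] (t : ℕ) (A : Set Ω),
        |((fun m : Measure Ω => m.bind (jitterHMC Φ hΦ S T η μP))^[t] μ₀).real A - π.real A|
          ≤ (1 - δ) ^ (t / (k + 1))) ∧
      ∀ (π' : Measure Ω) [IsProbabilityMeasure π'], Invariant (jitterHMC Φ hΦ S T η μP) π' → π' = π := by
  haveI := isMarkovKernel_jitterHMC Φ hΦ η μP hS hT
  have hmin := jitterHMC_nHit_minorised_of_common_minorant (hΦ := hΦ) (η := η) (μP := μP) hS hT hG hW h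
  have ha0 : η G ^ (k + 1) * a ≠ 0 := mul_ne_zero (pow_ne_zero _ hηG) ha
  haveI : IsMarkovKernel (nHit (jitterHMC Φ hΦ S T η μP) (k + 1)) := isMarkovKernel_nHit _ _
  obtain ⟨x₀⟩ := nonempty_of_isProbabilityMeasure π
  have ha1 : η G ^ (k + 1) * a ≤ 1 := by
    have h1 := Measure.le_iff'.1 (hmin x₀) univ
    rwa [Measure.smul_apply, smul_eq_mul, measure_univ, measure_univ, mul_one] at h1
  have hatop : η G ^ (k + 1) * a ≠ ⊤ := ne_top_of_le_ne_top ENNReal.one_ne_top ha1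
  refine ⟨(η G ^ (k + 1) * a).toReal, ENNReal.toReal_pos ha0 hatop,
    ENNReal.toReal_le_of_le_ofReal zero_le_one (by rwa [ENNReal.ofReal_one]),
    fun μ₀ _ t A => uniformlyErgodic_of_nHit_minorised hmin hinv μ₀ t A, fun π' _ hπ' => ?_⟩
  exact invariant_unique_of_minorised (κ := nHit (jitterHMC Φ hΦ S T η μP) (k + 1)) hmin
    (pos_iff_ne_zero.2 ha0) (invariant_nHit hinv _) (invariant_nHit hπ' _)

end CommonMinorant

end Summit.Ventures.LatticeQCDFlow.Exactness

end
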